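import Mathlib
import Literature.MathematicalPhysics.QuantumLattice.WilsonDiracAP
import Summits.QuantumFields.QCD.Theorems.QuarksAsStableActionWilsonQuarkStabilityStubCellGauge
import Summits.QuantumFields.QCD.Theorems.QuarksAsStableActionCriticalLineDiamagnetismStubCellGainOfGauged
import Summits.QuantumFields.QCD.Theorems.QuarksAsStableActionCriticalLineDiamagnetismStubCellIncidence
import Summits.QuantumFields.QCD.Theorems.QuarksAsStableActionCriticalLineDiamagnetismStubTilingCellData

/-!
# Re-gauging glue: the one-cell gain for good-gauge cells gives it for all small-link cells
(helper for crux stmt-QuantumFields-9734, line `Sketch`, stub `stub_cellRegauge`)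

What.  On the even torus `(ℤ/2M)⁴` the lead's assembly proves the one-cell gain in tiling form,
`‖det D_AP[tile_c V]‖ ≤ exp(K_g − c_g M⁴ S_cell(V)) ‖det D_AP[𝟙]‖`, for cells `c` whose `32` closed-cell
links have deficit `3 − Re tr V_e ≤ η` AND which are in a GOOD GAUGE: total cell-link deficit
`F_cell(V) ≤ C_B · S_cell(V)` (for every `C_B`, with constants depending on `C_B`).  We remove the gauge
condition: the same estimate holds for all `η'`-small cells, `η' := η / (528 (max C_B 0 + 1))`, where
`C_B` is the constant of the sibling line's cell gauge.

How (re-gauging).  By the landed cell gauge of the sibling line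
(`…WilsonQuarkStability.FreeTangentLandauChessboard.stub_cellGauge`, `L = 2M ≥ 4`) some gauge `g`
makes `F_cell(V^g) ≤ C_B Σ_{cell plaquettes} (3 − Re tr V_p)`; the sibling's `val`-filter of cell
plaquettes is contained in the items' `inCell` filter (`CellGainOfGauged.eq_of_val_sub_eq_zero`, …), so
`F_cell(W) ≤ max(C_B, 0) S_cell(V) = max(C_B, 0) S_cell(W)` for `W := V^g` (plaquette traces are gauge
invariant, `CellGainOfGauged.trace_plaquetteHolonomy_gaugeTransform`): `W` is in a good gauge.  Its cell
links are still small: a single cell-link deficit of `W` is at most `F_cell(W) ≤ max(C_B,0) S_cell(V)`,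
the cell has at most `24` plaquettes (`card_le_of_subset_cell`), and each cell plaquette deficit is at
most `8d₁ + 8d₂ + 4d₃ + 2d₄ ≤ 22 η'` in terms of the deficits of its four links, which are cell links
(`3 − Re tr(uv) ≤ 2(3 − Re tr u) + 2(3 − Re tr v)` on `U(3)`, iterated, `Re tr u⁻¹ = Re tr u`); so
`S_cell(V) ≤ 528 η'` and every cell link of `W` has deficit `≤ η`.  The good-gauge gain for `W` is the
gain for `V`: `tile_c (V^g) = (tile_c V)^{g ∘ fold_c}` (fold identity, even `L`,
`CellGainOfGauged.tile_gaugeTransform`) and the seam-twisted Wilson determinant is gauge invariant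
(`CellGainOfGauged.det_seam_gaugeTransform`).  The glue at fixed `M` (`CellRegauge.glue`) is stated in
the items' `tile` (by its defining equation) and in the four Finsets involved, which enter only through
membership hypotheses (decidability instances are matched by unification).
Sources: folklore gauge invariance; the trace inequality is adapted from the sibling file
`…WilsonQuarkStabilityStubCellGauge` (private there).  Pure theorem file (no definitions).
-/

noncomputable section

open scoped BigOperators Classical Matrix ComplexConjugate ComplexOrder
open Finset
open Literature.MathematicalPhysics.QuantumLattice Literature.MathematicalPhysics.QuantumFieldTheory
  Literature.Probability.LatticeModels

namespace Summit.QuantumFields.QCD.Cruxes.CriticalLineDiamagnetism.ChessboardCellGain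

namespace CellRegauge

/-! ### Trace deficits on `U(3)` -/

/-- The trace inequality on `U(3)`: `3 - Re tr (u v) ≤ 2 (3 - Re tr u) + 2 (3 - Re tr v)`
(`0 ≤ Re tr Zᴴ Z` for `Z = (1 - uᴴ) + (1 - v)`, i.e. `‖1 - uv‖_F² ≤ 2‖1 - u‖_F² + 2‖1 - v‖_F²`). -/
theorem deficit_mul_le (u v : Matrix.unitaryGroup (Fin 3) ℂ) :
    3 - (((u * v : Matrix.unitaryGroup (Fin 3) ℂ)) : Matrix (Fin 3) (Fin 3) ℂ).trace.re ≤
      2 * (3 - ((u : Matrix (Fin 3) (Fin 3) ℂ)).trace.re) +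
        2 * (3 - ((v : Matrix (Fin 3) (Fin 3) ℂ)).trace.re) := by
  -- adapted from `deficit_mul_le` / `deficit_mul_le₃` of `…WilsonQuarkStabilityStubCellGauge.lean`
  rw [Matrix.UnitaryGroup.mul_val]
  set A : Matrix (Fin 3) (Fin 3) ℂ := u.1 with hA
  set B : Matrix (Fin 3) (Fin 3) ℂ := v.1 with hB
  have hA' : A * Aᴴ = 1 := by
    simpa only [Matrix.star_eq_conjTranspose] using Matrix.mem_unitaryGroup_iff.mp u.2
  have hB' : Bᴴ * B = 1 := by
    simpa only [Matrix.star_eq_conjTranspose] using Matrix.mem_unitaryGroup_iff'.mp v.2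
  have hpos : 0 ≤ (((1 - Aᴴ) + (1 - B))ᴴ * ((1 - Aᴴ) + (1 - B))).trace.re :=
    (Complex.nonneg_iff.mp (Matrix.posSemidef_conjTranspose_mul_self _).trace_nonneg).1
  have hexp : ((1 - Aᴴ) + (1 - B))ᴴ * ((1 - Aᴴ) + (1 - B)) =
      (1 + 1 - A - Aᴴ) + (1 - A - B + A * B) + (1 - Aᴴ - Bᴴ + Bᴴ * Aᴴ) + (1 + 1 - B - Bᴴ) := by
    rw [Matrix.conjTranspose_add, Matrix.conjTranspose_sub, Matrix.conjTranspose_sub,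
      Matrix.conjTranspose_one, Matrix.conjTranspose_conjTranspose]
    have e : ((1 : Matrix (Fin 3) (Fin 3) ℂ) - A + (1 - Bᴴ)) * (1 - Aᴴ + (1 - B)) =
        (1 + 1 - A - Aᴴ) + (1 - A - B + A * B) + (1 - Aᴴ - Bᴴ + Bᴴ * Aᴴ) + (1 + 1 - B - Bᴴ) +
          (A * Aᴴ - 1) + (Bᴴ * B - 1) := by
      noncomm_ring
    rw [e, hA', hB', sub_self, add_zero, add_zero]
  have hre : ∀ X : Matrix (Fin 3) (Fin 3) ℂ, Xᴴ.trace.re = X.trace.re := fun X => by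
    rw [Matrix.trace_conjTranspose, Complex.star_def, Complex.conj_re]
  have h3 : (Bᴴ * Aᴴ).trace.re = (A * B).trace.re := by
    rw [← Matrix.conjTranspose_mul, Matrix.trace_conjTranspose, Complex.star_def, Complex.conj_re]
  rw [hexp] at hpos
  simp only [Matrix.trace_add, Matrix.trace_sub, Matrix.trace_one, Fintype.card_fin, Nat.cast_ofNat,
    Complex.re_ofNat, Complex.add_re, Complex.sub_re, hre, h3] at hpos
  linarith

/-- **A plaquette deficit is controlled by the deficits of its four links**:
`3 - Re tr U_p ≤ 8 d₁ + 8 d₂ + 4 d₃ + 2 d₄` for `U_p = U₁ U₂ U₃⁻¹ U₄⁻¹` (iterate `deficit_mul_le`,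
`Re tr u⁻¹ = Re tr u`). -/
theorem plaquette_deficit_le {L : ℕ} (U : GaugeConfig 4 L (Matrix.unitaryGroup (Fin 3) ℂ))
    (x : Site 4 L) (μ ν : Fin 4) :
    3 - (((plaquetteHolonomy U x μ ν : Matrix.unitaryGroup (Fin 3) ℂ)) :
        Matrix (Fin 3) (Fin 3) ℂ).trace.re ≤
      8 * (3 - ((U (x, μ) : Matrix.unitaryGroup (Fin 3) ℂ) : Matrix (Fin 3) (Fin 3) ℂ).trace.re) +
      8 * (3 - ((U (Site.shift x μ, ν) : Matrix.unitaryGroup (Fin 3) ℂ) :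
        Matrix (Fin 3) (Fin 3) ℂ).trace.re) +
      4 * (3 - ((U (Site.shift x ν, μ) : Matrix.unitaryGroup (Fin 3) ℂ) :
        Matrix (Fin 3) (Fin 3) ℂ).trace.re) +
      2 * (3 - ((U (x, ν) : Matrix.unitaryGroup (Fin 3) ℂ) : Matrix (Fin 3) (Fin 3) ℂ).trace.re) := by
  have h1 := deficit_mul_le (U (x, μ) * U (Site.shift x μ, ν) * (U (Site.shift x ν, μ))⁻¹) (U (x, ν))⁻¹
  have h2 := deficit_mul_le (U (x, μ) * U (Site.shift x μ, ν)) (U (Site.shift x ν, μ))⁻¹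
  have h3 := deficit_mul_le (U (x, μ)) (U (Site.shift x μ, ν))
  rw [TilingCellData.trace_re_inv] at h1 h2
  unfold plaquetteHolonomy
  linarith

/-! ### The four links of a cell plaquette are cell links -/

/-- `x ∈ {c, c + 1}` gives `val (x - c) ≤ 1` in `ZMod L` (any `L`). -/
theorem val_sub_le_one_of {L : ℕ} {x c : ZMod L} (h : x = c ∨ x = c + 1) : (x - c).val ≤ 1 := by
  rcases h with rfl | rfl
  · rw [sub_self, ZMod.val_zero]; exact zero_le_one
  · rw [add_sub_cancel_left, ZMod.val_one_eq_one_mod]; exact Nat.mod_le 1 L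

/-- **The four links of a plaquette of the closed unit cell at `c` are cell links** (all offsets
`val (y_κ - c_κ) ≤ 1`, offset `0` in the link direction): for the plaquette at `x` in the plane
`(μ, ν)` with `x_μ = c_μ`, `x_ν = c_ν` and transverse coordinates in `{c, c + 1}`, the links
`(x, μ)`, `(x + μ̂, ν)`, `(x + ν̂, μ)`, `(x, ν)`. -/
theorem links_of_inCell {L : ℕ} {c x : Site 4 L} {μ ν : Fin 4} (hμν : μ ≠ ν)
    (h1 : x μ = c μ) (h2 : x ν = c ν) (h3 : ∀ κ, κ ≠ μ → κ ≠ ν → (x κ = c κ ∨ x κ = c κ + 1)) :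
    ((∀ κ, (x κ - c κ).val ≤ 1) ∧ (x μ - c μ).val = 0) ∧
    ((∀ κ, (Site.shift x μ κ - c κ).val ≤ 1) ∧ (Site.shift x μ ν - c ν).val = 0) ∧
    ((∀ κ, (Site.shift x ν κ - c κ).val ≤ 1) ∧ (Site.shift x ν μ - c μ).val = 0) ∧
    ((∀ κ, (x κ - c κ).val ≤ 1) ∧ (x ν - c ν).val = 0) := by
  have hx : ∀ κ, x κ = c κ ∨ x κ = c κ + 1 := fun κ => by
    by_cases hκμ : κ = μ
    · rw [hκμ]; exact Or.inl h1
    by_cases hκν : κ = ν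
    · rw [hκν]; exact Or.inl h2
    exact h3 κ hκμ hκν
  have hxv : ∀ κ, (x κ - c κ).val ≤ 1 := fun κ => val_sub_le_one_of (hx κ)
  have hzero : ∀ {a b : ZMod L}, a = b → (a - b).val = 0 := fun h => by
    rw [h, sub_self, ZMod.val_zero]
  have hshift : ∀ ρ : Fin 4, x ρ = c ρ → ∀ κ, (Site.shift x ρ κ - c κ).val ≤ 1 := fun ρ hρ κ => by
    by_cases hκ : κ = ρ
    · rw [hκ, FreeDetFormula.shift_apply_self]
      exact val_sub_le_one_of (Or.inr (by rw [hρ]))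
    · rw [FreeDetFormula.shift_apply_of_ne x hκ]
      exact hxv κ
  refine ⟨⟨hxv, hzero h1⟩, ⟨hshift μ h1, ?_⟩, ⟨hshift ν h2, ?_⟩, ⟨hxv, hzero h2⟩⟩
  · rw [FreeDetFormula.shift_apply_of_ne x hμν.symm]; exact hzero h2
  · rw [FreeDetFormula.shift_apply_of_ne x hμν]; exact hzero h1

/-! ### The glue at fixed `M` -/

/-- **The re-gauging glue at fixed `M`** (abstract in the items' `tile`, given by its defining
equation, in the two cell Finsets `EF`, `PF` of the sibling cell gauge, and in the two Finsets `EF'`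
(cell links) and `CF` (cell plaquettes) of the items).  If `g` is a cell gauge for `V` at `c`
(`Σ_{EF} deficit(V^g) ≤ C_B Σ_{PF} deficit(V)`), the cell links of `V` are `η`-small with
`max(C_B, 0) · 528 η ≤ η_g`, and the one-cell gain holds at link threshold `η_g` for good-gauge fields
(`Σ_{EF'} deficit ≤ max(C_B, 0) Σ_{CF} deficit`), then the one-cell gain holds for `V`. -/
theorem glue {M : ℕ} [NeZero M] {ηg η CB cg Kg m : ℝ} (hη : 0 ≤ η) (hCB : max CB 0 * (528 * η) ≤ ηg)
    {tile : Site 4 (2 * M) → GaugeConfig 4 (2 * M) (Matrix.unitaryGroup (Fin 3) ℂ) →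
      GaugeConfig 4 (2 * M) (Matrix.unitaryGroup (Fin 3) ℂ)}
    (htile : ∀ (c : Site 4 (2 * M)) (V : GaugeConfig 4 (2 * M) (Matrix.unitaryGroup (Fin 3) ℂ))
      (e : Edge 4 (2 * M)), tile c V e = if (e.1 e.2 - c e.2).val % 2 = 0
        then V (fun ν => c ν + (((e.1 ν - c ν).val % 2 : ℕ) : ZMod (2 * M)), e.2)
        else (V (fun ν => c ν + (((Site.shift e.1 e.2 ν - c ν).val % 2 : ℕ) : ZMod (2 * M)), e.2))⁻¹)
    (V : GaugeConfig 4 (2 * M) (Matrix.unitaryGroup (Fin 3) ℂ)) (c : Site 4 (2 * M))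
    (hlinks : ∀ e : Edge 4 (2 * M), ((∀ ν, (e.1 ν - c ν).val ≤ 1) ∧ (e.1 e.2 - c e.2).val = 0) →
      3 - ((V e : Matrix.unitaryGroup (Fin 3) ℂ) : Matrix (Fin 3) (Fin 3) ℂ).trace.re ≤ η)
    (g : Site 4 (2 * M) → Matrix.unitaryGroup (Fin 3) ℂ)
    {EF EF' : Finset (Edge 4 (2 * M))} {PF CF : Finset (Plaquette 4 (2 * M))}
    (hg : (∑ e ∈ EF, (3 - (((gaugeTransform g V e : Matrix.unitaryGroup (Fin 3) ℂ) :
        Matrix (Fin 3) (Fin 3) ℂ)).trace.re)) ≤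
      CB * ∑ p ∈ PF, (3 - (((plaquetteHolonomy V p.1 p.2.1.1 p.2.1.2 : Matrix.unitaryGroup (Fin 3) ℂ) :
        Matrix (Fin 3) (Fin 3) ℂ)).trace.re))
    (hEF : ∀ e : Edge 4 (2 * M), ((∀ ν, (e.1 ν - c ν).val ≤ 1) ∧ (e.1 e.2 - c e.2).val = 0) → e ∈ EF)
    (hEF' : ∀ e ∈ EF', (∀ ν, (e.1 ν - c ν).val ≤ 1) ∧ (e.1 e.2 - c e.2).val = 0)
    (hPF : ∀ p ∈ PF, (∀ ν, (p.1 ν - c ν).val ≤ 1) ∧ (p.1 p.2.1.1 - c p.2.1.1).val = 0 ∧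
      (p.1 p.2.1.2 - c p.2.1.2).val = 0)
    (hCF : ∀ p : Plaquette 4 (2 * M), (p.1 p.2.1.1 = c p.2.1.1 ∧ p.1 p.2.1.2 = c p.2.1.2 ∧
      ∀ ν, ν ≠ p.2.1.1 → ν ≠ p.2.1.2 → (p.1 ν = c ν ∨ p.1 ν = c ν + 1)) → p ∈ CF)
    (hG : ∀ W : GaugeConfig 4 (2 * M) (Matrix.unitaryGroup (Fin 3) ℂ),
      (∀ e : Edge 4 (2 * M), ((∀ ν, (e.1 ν - c ν).val ≤ 1) ∧ (e.1 e.2 - c e.2).val = 0) →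
        3 - ((W e : Matrix.unitaryGroup (Fin 3) ℂ) : Matrix (Fin 3) (Fin 3) ℂ).trace.re ≤ ηg) →
      (∑ e ∈ EF', (3 - ((W e : Matrix.unitaryGroup (Fin 3) ℂ) : Matrix (Fin 3) (Fin 3) ℂ).trace.re)) ≤
        max CB 0 * ∑ p ∈ CF, (3 - (unitaryFundamentalRep (Fin 3) ℂ
          (plaquetteHolonomy W p.1 p.2.1.1 p.2.1.2)).trace.re) →
      ‖(wilsonDirac (unitaryFundamentalRep (Fin 3) ℂ)
          (fun e => if (e.1 e.2).val + 1 = 2 * M then -(tile c W e) else tile c W e) m 1).det‖ ≤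
        Real.exp (Kg - cg * (M : ℝ) ^ 4 * ∑ p ∈ CF, (3 - (unitaryFundamentalRep (Fin 3) ℂ
          (plaquetteHolonomy W p.1 p.2.1.1 p.2.1.2)).trace.re)) *
          ‖(wilsonDirac (unitaryFundamentalRep (Fin 3) ℂ)
              (fun e : Edge 4 (2 * M) => if (e.1 e.2).val + 1 = 2 * M then
                (-1 : Matrix.unitaryGroup (Fin 3) ℂ) else 1) m 1).det‖) :
    ‖(wilsonDirac (unitaryFundamentalRep (Fin 3) ℂ)
        (fun e => if (e.1 e.2).val + 1 = 2 * M then -(tile c V e) else tile c V e) m 1).det‖ ≤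
      Real.exp (Kg - cg * (M : ℝ) ^ 4 * ∑ p ∈ CF, (3 - (unitaryFundamentalRep (Fin 3) ℂ
        (plaquetteHolonomy V p.1 p.2.1.1 p.2.1.2)).trace.re)) *
        ‖(wilsonDirac (unitaryFundamentalRep (Fin 3) ℂ)
            (fun e : Edge 4 (2 * M) => if (e.1 e.2).val + 1 = 2 * M then
              (-1 : Matrix.unitaryGroup (Fin 3) ℂ) else 1) m 1).det‖ := by
  -- (1) the plaquettes of `PF` lie in the closed cell: at most `24` of them, each of deficit `≤ 22 η`
  have hPFcell : ∀ p ∈ PF, p.1 p.2.1.1 = c p.2.1.1 ∧ p.1 p.2.1.2 = c p.2.1.2 ∧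
      ∀ κ, κ ≠ p.2.1.1 → κ ≠ p.2.1.2 → (p.1 κ = c κ ∨ p.1 κ = c κ + 1) := fun p hp => by
    obtain ⟨h1, h2, h3⟩ := hPF p hp
    exact ⟨CellGainOfGauged.eq_of_val_sub_eq_zero h2, CellGainOfGauged.eq_of_val_sub_eq_zero h3,
      fun κ _ _ => CellGainOfGauged.eq_or_eq_add_one_of_val_sub_le_one (h1 κ)⟩
  have hcard : PF.card ≤ 24 := card_le_of_subset_cell c PF hPFcell
  have hplaq : ∀ p ∈ PF, 3 - (((plaquetteHolonomy V p.1 p.2.1.1 p.2.1.2 :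
      Matrix.unitaryGroup (Fin 3) ℂ) : Matrix (Fin 3) (Fin 3) ℂ)).trace.re ≤ 22 * η := by
    intro p hp
    obtain ⟨h1, h2, h3⟩ := hPFcell p hp
    obtain ⟨l1, l2, l3, l4⟩ := links_of_inCell (ne_of_lt p.2.2) h1 h2 h3
    have d1 := hlinks (p.1, p.2.1.1) l1
    have d2 := hlinks (Site.shift p.1 p.2.1.1, p.2.1.2) l2
    have d3 := hlinks (Site.shift p.1 p.2.1.2, p.2.1.1) l3
    have d4 := hlinks (p.1, p.2.1.2) l4
    have h0 := plaquette_deficit_le V p.1 p.2.1.1 p.2.1.2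
    linarith
  have hS0 : 0 ≤ ∑ p ∈ PF, (3 - (((plaquetteHolonomy V p.1 p.2.1.1 p.2.1.2 :
      Matrix.unitaryGroup (Fin 3) ℂ) : Matrix (Fin 3) (Fin 3) ℂ)).trace.re) :=
    Finset.sum_nonneg fun p _ => CellGainOfGauged.deficit_nonneg _
  have hSle : ∑ p ∈ PF, (3 - (((plaquetteHolonomy V p.1 p.2.1.1 p.2.1.2 :
      Matrix.unitaryGroup (Fin 3) ℂ) : Matrix (Fin 3) (Fin 3) ℂ)).trace.re) ≤ 528 * η :=
    calc ∑ p ∈ PF, (3 - (((plaquetteHolonomy V p.1 p.2.1.1 p.2.1.2 :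
          Matrix.unitaryGroup (Fin 3) ℂ) : Matrix (Fin 3) (Fin 3) ℂ)).trace.re)
        ≤ ∑ _p ∈ PF, 22 * η := Finset.sum_le_sum hplaq
      _ = PF.card * (22 * η) := by rw [Finset.sum_const, nsmul_eq_mul]
      _ ≤ 24 * (22 * η) :=
          mul_le_mul_of_nonneg_right (by exact_mod_cast hcard) (mul_nonneg (by norm_num) hη)
      _ = 528 * η := by ring
  -- (2) in the cell gauge every cell link of `W := V^g` has deficit at most `ηg`
  have hmax : CB ≤ max CB 0 := le_max_left _ _
  have hmax0 : 0 ≤ max CB 0 := le_max_right _ _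
  have hFW : ∑ e ∈ EF, (3 - (((gaugeTransform g V e : Matrix.unitaryGroup (Fin 3) ℂ) :
      Matrix (Fin 3) (Fin 3) ℂ)).trace.re) ≤
      max CB 0 * ∑ p ∈ PF, (3 - (((plaquetteHolonomy V p.1 p.2.1.1 p.2.1.2 :
        Matrix.unitaryGroup (Fin 3) ℂ) : Matrix (Fin 3) (Fin 3) ℂ)).trace.re) :=
    hg.trans (mul_le_mul_of_nonneg_right hmax hS0)
  have hlinksW : ∀ e : Edge 4 (2 * M), ((∀ ν, (e.1 ν - c ν).val ≤ 1) ∧ (e.1 e.2 - c e.2).val = 0) →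
      3 - ((gaugeTransform g V e : Matrix.unitaryGroup (Fin 3) ℂ) :
        Matrix (Fin 3) (Fin 3) ℂ).trace.re ≤ ηg := by
    intro e he
    have h1 := Finset.single_le_sum (f := fun e : Edge 4 (2 * M) =>
        3 - (((gaugeTransform g V e : Matrix.unitaryGroup (Fin 3) ℂ) :
          Matrix (Fin 3) (Fin 3) ℂ)).trace.re) (fun e _ => CellGainOfGauged.deficit_nonneg _) (hEF e he)
    exact h1.trans (hFW.trans ((mul_le_mul_of_nonneg_left hSle hmax0).trans hCB))
  -- (3) `W` is in a good gauge: `EF' ⊆ EF`, `PF ⊆ CF`, and `S_cell` is gauge invariant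
  have hsumCF : ∀ U : GaugeConfig 4 (2 * M) (Matrix.unitaryGroup (Fin 3) ℂ),
      ∑ p ∈ CF, (3 - (unitaryFundamentalRep (Fin 3) ℂ
        (plaquetteHolonomy (gaugeTransform g U) p.1 p.2.1.1 p.2.1.2)).trace.re) =
      ∑ p ∈ CF, (3 - (unitaryFundamentalRep (Fin 3) ℂ
        (plaquetteHolonomy U p.1 p.2.1.1 p.2.1.2)).trace.re) := fun U =>
    Finset.sum_congr rfl fun p _ => by
      rw [CellGainOfGauged.trace_plaquetteHolonomy_gaugeTransform]
  have hEFsub : EF' ⊆ EF := fun e he => hEF e (hEF' e he)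
  have hPFsub : PF ⊆ CF := fun p hp => hCF p (hPFcell p hp)
  have hPC : ∑ p ∈ PF, (3 - (((plaquetteHolonomy V p.1 p.2.1.1 p.2.1.2 :
      Matrix.unitaryGroup (Fin 3) ℂ) : Matrix (Fin 3) (Fin 3) ℂ)).trace.re) ≤
      ∑ p ∈ CF, (3 - (unitaryFundamentalRep (Fin 3) ℂ
        (plaquetteHolonomy V p.1 p.2.1.1 p.2.1.2)).trace.re) := by
    simp only [unitaryFundamentalRep_apply]
    exact Finset.sum_le_sum_of_subset_of_nonneg hPFsub fun p _ _ => CellGainOfGauged.deficit_nonneg _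
  have hgauge : ∑ e ∈ EF', (3 - ((gaugeTransform g V e : Matrix.unitaryGroup (Fin 3) ℂ) :
      Matrix (Fin 3) (Fin 3) ℂ).trace.re) ≤
      max CB 0 * ∑ p ∈ CF, (3 - (unitaryFundamentalRep (Fin 3) ℂ
        (plaquetteHolonomy (gaugeTransform g V) p.1 p.2.1.1 p.2.1.2)).trace.re) := by
    rw [hsumCF V]
    exact ((Finset.sum_le_sum_of_subset_of_nonneg hEFsub
      fun e _ _ => CellGainOfGauged.deficit_nonneg _).trans hFW).trans
        (mul_le_mul_of_nonneg_left hPC hmax0)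
  -- (4) the good-gauge gain for `W`, transported back to `V`
  have key := hG (gaugeTransform g V) hlinksW hgauge
  rw [hsumCF V, CellGainOfGauged.tile_gaugeTransform (even_two_mul M) htile g V c,
    CellGainOfGauged.det_seam_gaugeTransform] at key
  exact key

end CellRegauge

/-- **Stub 3h — `cellRegauge` (glue).**  The one-cell gain in tiling form for cells in a GOOD GAUGE
(total cell-link deficit `F_cell ≤ C_B · S_cell`, for every `C_B`) implies it for all small-link cells:
by the sibling cell gauge (`stub_cellGauge`, `L = 2M ≥ 4`) every cell has a gauge copy with
`F ≤ C_B S`, whose links are still small (`S_cell ≤ 528 ·` the maximal cell-link deficit), while the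
tiling determinant (`CellGainOfGauged.tile_gaugeTransform`, `det_seam_gaugeTransform`) and `S_cell`
(`trace_plaquetteHolonomy_gaugeTransform`) are gauge invariant (`CellRegauge.glue`); the new threshold is
`η / (528 (max C_B 0 + 1))` and `M₀` becomes `max M₀ 2`. -/
theorem stub_cellRegauge : (∀ CB : ℝ, ∃ η cg Kg ε : ℝ, 0 < η ∧ 0 < cg ∧ 0 < ε ∧ ∃ M₀ : ℕ, ∀ (M : ℕ) [NeZero M], M₀ ≤ M → ∀ (m : ℝ), |m| ≤ ε → ∀ (V : GaugeConfig 4 (2 * M) (Matrix.unitaryGroup (Fin 3) ℂ)) (c : Site 4 (2 * M)), (∀ e : Edge 4 (2 * M), ((∀ ν, (e.1 ν - c ν).val ≤ 1) ∧ (e.1 e.2 - c e.2).val = 0) → 3 - (V e).1.trace.re ≤ η) → (∑ e ∈ univ.filter (fun e : Edge 4 (2 * M) => (∀ ν, (e.1 ν - c ν).val ≤ 1) ∧ (e.1 e.2 - c e.2).val = 0), (3 - (V e).1.trace.re)) ≤ CB * ∑ p ∈ univ.filter (fun p : Plaquette 4 (2 * M) => p.1 p.2.1.1 = c p.2.1.1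 ∧ p.1 p.2.1.2 = c p.2.1.2 ∧ ∀ ν, ν ≠ p.2.1.1 → ν ≠ p.2.1.2 → (p.1 ν = c ν ∨ p.1 ν = c ν + 1)), (3 - (unitaryFundamentalRep (Fin 3) ℂ (plaquetteHolonomy V p.1 p.2.1.1 p.2.1.2)).trace.re) → let tile : Site 4 (2 * M) → GaugeConfig 4 (2 * M) (Matrix.unitaryGroup (Fin 3) ℂ) → GaugeConfig 4 (2 * M) (Matrix.unitaryGroup (Fin 3) ℂ) := fun c V e => if (e.1 e.2 - c e.2).val % 2 = 0 then V (fun ν => c ν + (((e.1 ν - c ν).val % 2 : ℕ) : ZMod (2 * M)), e.2) else (V (fun ν => c ν + (((Site.shift e.1 e.2 ν - c ν).val % 2 : ℕ) : ZMod (2 * M)), e.2))⁻¹; ‖(wilsonDirac (unitaryFundamentalRep (Fin 3) ℂ) (fun e => if (e.1 e.2).val + 1 = 2 * M then -(tile c V e) else tile c V e) m 1).det‖ ≤ Real.exp (Kg - cg * (M : ℝ) ^ 4 * ∑ p ∈ univ.filter (fun p : Plaquette 4 (2 * M) => p.1 p.2.1.1 = c p.2.1.1 ∧ p.1 p.2.1.2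 = c p.2.1.2 ∧ ∀ ν, ν ≠ p.2.1.1 → ν ≠ p.2.1.2 → (p.1 ν = c ν ∨ p.1 ν = c ν + 1)), (3 - (unitaryFundamentalRep (Fin 3) ℂ (plaquetteHolonomy V p.1 p.2.1.1 p.2.1.2)).trace.re)) * ‖(wilsonDirac (unitaryFundamentalRep (Fin 3) ℂ) (fun e : Edge 4 (2 * M) => if (e.1 e.2).val + 1 = 2 * M then (-1 : Matrix.unitaryGroup (Fin 3) ℂ) else 1) m 1).det‖) → (∃ η cg Kg ε : ℝ, 0 < η ∧ 0 < cg ∧ 0 < ε ∧ ∃ M₀ : ℕ, ∀ (M : ℕ) [NeZero M], M₀ ≤ M → ∀ (m : ℝ), |m| ≤ ε → ∀ (V : GaugeConfig 4 (2 * M) (Matrix.unitaryGroup (Fin 3) ℂ)) (c : Site 4 (2 * M)), (∀ e : Edge 4 (2 * M), ((∀ ν, (e.1 ν - c ν).val ≤ 1) ∧ (e.1 e.2 - c e.2).val = 0) → 3 - ((V e : Matrix.unitaryGroup (Fin 3) ℂ) : Matrix (Fin 3) (Fin 3) ℂ).trace.re ≤ η) → let tile : Site 4 (2 * M) → GaugeConfig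 4 (2 * M) (Matrix.unitaryGroup (Fin 3) ℂ) → GaugeConfig 4 (2 * M) (Matrix.unitaryGroup (Fin 3) ℂ) := fun c V e => if (e.1 e.2 - c e.2).val % 2 = 0 then V (fun ν => c ν + (((e.1 ν - c ν).val % 2 : ℕ) : ZMod (2 * M)), e.2) else (V (fun ν => c ν + (((Site.shift e.1 e.2 ν - c ν).val % 2 : ℕ) : ZMod (2 * M)), e.2))⁻¹; ‖(wilsonDirac (unitaryFundamentalRep (Fin 3) ℂ) (fun e => if (e.1 e.2).val + 1 = 2 * M then -(tile c V e) else tile c V e) m 1).det‖ ≤ Real.exp (Kg - cg * (M : ℝ) ^ 4 * ∑ p ∈ univ.filter (fun p : Plaquette 4 (2 * M) => p.1 p.2.1.1 = c p.2.1.1 ∧ p.1 p.2.1.2 = c p.2.1.2 ∧ ∀ ν, ν ≠ p.2.1.1 → ν ≠ p.2.1.2 → (p.1 ν = c ν ∨ p.1 ν = c ν + 1)), (3 - (unitaryFundamentalRep (Fin 3) ℂ (plaquetteHolonomy V p.1 p.2.1.1 p.2.1.2)).trace.re)) * ‖(wilsonDirac (unitaryFundamentalRep (Fin 3) ℂ)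 (fun e : Edge 4 (2 * M) => if (e.1 e.2).val + 1 = 2 * M then (-1 : Matrix.unitaryGroup (Fin 3) ℂ) else 1) m 1).det‖) := by
  intro H
  obtain ⟨CB, hB⟩ :=
    Summit.QuantumFields.QCD.Cruxes.WilsonQuarkStability.FreeTangentLandauChessboard.stub_cellGauge
  obtain ⟨ηg, cg, Kg, ε, hηg, hcg, hε, M₀, hgood⟩ := H (max CB 0)
  have hC : (0 : ℝ) < 528 * (max CB 0 + 1) := by positivity
  have hη : 0 < ηg / (528 * (max CB 0 + 1)) := div_pos hηg hC
  refine ⟨ηg / (528 * (max CB 0 + 1)), cg, Kg, ε, hη, hcg, hε, max M₀ 2, ?_⟩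
  intro M _ hM m hm V c hlinks tile
  have hM₀ : M₀ ≤ M := le_of_max_le_left hM
  have hM2 : 2 ≤ M := le_of_max_le_right hM
  obtain ⟨g, hg⟩ := hB (2 * M) (by omega) V c
  -- the defining equation of the `let`
  have htile : ∀ (c : Site 4 (2 * M)) (V : GaugeConfig 4 (2 * M) (Matrix.unitaryGroup (Fin 3) ℂ))
      (e : Edge 4 (2 * M)), tile c V e = if (e.1 e.2 - c e.2).val % 2 = 0
        then V (fun ν => c ν + (((e.1 ν - c ν).val % 2 : ℕ) : ZMod (2 * M)), e.2)
        else (V (fun ν => c ν + (((Site.shift e.1 e.2 ν - c ν).val % 2 : ℕ) : ZMod (2 * M)), e.2))⁻¹ :=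
    fun _ _ _ => rfl
  -- the threshold arithmetic: `max C_B 0 · 528 η' ≤ η_g`
  have hCB : max CB 0 * (528 * (ηg / (528 * (max CB 0 + 1)))) ≤ ηg := by
    have hkey : ηg / (528 * (max CB 0 + 1)) * (528 * (max CB 0 + 1)) = ηg := div_mul_cancel₀ ηg hC.ne'
    nlinarith [hη.le, le_max_right CB 0]
  refine CellRegauge.glue (m := m) hη.le hCB htile V c hlinks g hg ?_ ?_ ?_ ?_
    (fun W h1 h2 => hgood M hM₀ m hm W c h1 h2)
  · exact fun e he => CellGainOfGauged.mem_filter_univ_of he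
  · exact fun e he => (CellGainOfGauged.of_mem_filter_univ he :)
  · exact fun p hp => (CellGainOfGauged.of_mem_filter_univ hp :)
  · exact fun p hp => CellGainOfGauged.mem_filter_univ_of hp

end Summit.QuantumFields.QCD.Cruxes.CriticalLineDiamagnetism.ChessboardCellGain

end
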